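import Mathlib
import HarnessLib
import Literature.Combinatorics.Additive.KempermanElementaryPairs
import Literature.Combinatorics.Additive.CriticalSumProgressionOrQuasiPeriodic

/-!
# Lifting Kemperman decompositions from the bottom pair (Kemperman 1960, proof of Theorem 5.1)

[cite: Kemperman1960, Thm 5.1 (proof)] [tag: critical-pair] [tag: inverse-theorem]

Topic `Literature/Combinatorics/Additive`.  Cell `mm-stpp` (D-0046), seat `mm-stpp-lit` (gen 22); the
INDUCTIVE STEP of the «only if» half of the Kemperman Structure Theorem (Kemperman's form,
`IsKempermanDecompI`) along the Boothby–DeVos–Montejano chain (cell memo `KST-BRIDGE-PLAN.md` §§4–5):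
the bottom case is `PuncturedGroupCriticalPairs.lean`; what remains after this file is the COARSE
DATA of each pair of an impure beat / impure chord in normal position (memo §4) and the walk itself
(as in `CriticalSumProgressionOrQuasiPeriodic.lean`).

SOURCE.  J. H. B. Kemperman, *On small sumsets in an abelian group*, Acta Math. **103** (1960)
63–88, §5, proof of Theorem 5.1 (pp. 80–81 = p0018–p0019 of the held text
`paper:doi-10-1007-bf02546525`): having `(F, C'') ∈ P₁(A, B)` of norm one with `|F|` minimal and
`A₁ = A ∩ σ⁻¹(ā)`, `B₁ = B ∩ σ⁻¹(b̄)`, «it suffices to verify that `P₁(A₁, B₁) ⊆ P₁(A, B)` (3)» — a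
finer structure of the bottom pair is a finer structure of the whole pair —, together with «if
`A + B` is periodic then `A₁ + B₁` is periodic, hence, `C₁''` contains an element `c` with
`ν_c(A₁, B₁) = ν_c(A, B) = 1`» (the bottom pair inherits hypothesis (2)).  We phrase `(F, C'') ∈ P₁`
of norm one as COARSE DATA: quasi-periodic decompositions `A = A₁ ⊔ A'`, `B = B₁ ⊔ B'` with
quasi-period `H`, `φ_H(A') + φ_H(B')` uniquely expressed in `φ_H(A) + φ_H(B)`, and
`|φ_H(A + B)| = |φ_H(A)| + |φ_H(B)| − 1`.

MAIN RESULTS (0 named facts; everything PROVED).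
* `cosetCount_eq_mul_of_isPeriodicWith` — `|φ_K(X)| = |φ_K(H)|·|φ_H(X)|` for `K ≤ H` and `H`-periodic
  `X` (the index bookkeeping).
* `IsKempermanDecompI.lift` — coarse data rel. `H` + a Kemperman decomposition of the bottom pair
  with quasi-period `K ≤ H` ⟹ a Kemperman decomposition of `(A, B)` with quasi-period `K`, periodic
  parts `A₁ ∪ A₁'`, `B₁ ∪ B₁'`, same bottom pair (Kemperman's inclusion (3));
  `IsKempermanDecompI.of_coarse_elementary` (bottom pair elementary ⟹ quasi-period `H`);
  `le_of_isQuasiPeriodicDecomp_of_sub_mem` («`F₁` is a subgroup of `F`»);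
  `exists_isKempermanDecompI_of_coarse` (existence form, any `K`).
* Inheritance of hypothesis (2): `addConvolution_bottom_of_coarse` (a unique expression element of
  `A + B` is one of `A' + B'`, unless `|A'| = 1` or `|B'| = 1` — it cannot come from two periodic parts
  since `|H| ≥ 2`, and a mixed representation `a' + b₁` propagates along `A'`),
  `not_isPeriodic_bottom_of_coarse` (a period of `A' + B'` lies in `H` and is then a period of `A + B`).
* `exists_isKempermanDecompI_of_coarse_of_imp` — THE INDUCTIVE STEP: coarse data + «the bottom pair
  is a Kemperman pair whenever it satisfies (2)» ⟹ «`(A, B)` is a Kemperman pair whenever it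
  satisfies (2)» (type (I) escape when `|A'| = 1` or `|B'| = 1`).
Also `sub_notMem_of_coarse`, `add_eq_of_coarse`, `IsPeriodicWith.anti`.

## References
* J. H. B. Kemperman, *On small sumsets in an abelian group*, Acta Math. 103 (1960) 63–88,
  doi:10.1007/BF02546525, §5 (Theorem 5.1 and its proof, pp. 78–81; `P(A,B)`, `P₁(A,B)` §4 p. 74)
  — held `paper:doi-10-1007-bf02546525`, p0016–p0019 read 2026-08-29 [cite: Kemperman1960, Thm 5.1].
* D. J. Grynkiewicz, *Quasi-periodic decompositions and the Kemperman structure theorem*, European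
  J. Combin. 26 (2005) 559–575, §2 (KST I) [cite: Grynkiewicz2005, §2].
* D. J. Grynkiewicz, *A step beyond Kemperman's structure theorem*, Mathematika 55 (2009) 67–114, §2
  [cite: Grynkiewicz2009, §2].
-/

namespace Literature.Combinatorics.Additive

open Finset
open scoped Pointwise

variable {G : Type*} [AddCommGroup G] [DecidableEq G]

/-! ### Counting cosets of a smaller subgroup -/

/-- For `L ≤ H` and an `H`-periodic `X`: `|φ_L(X)| = [H : L] · |φ_H(X)|`, with `[H : L] = |φ_L(H)|`.
[cite: Kemperman1960, Thm 5.1 (proof, (3))] -/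
theorem cosetCount_eq_mul_of_isPeriodicWith {L H : AddSubgroup G} (hLH : L ≤ H) {Hf : Finset G}
    (hHf : ∀ g, g ∈ Hf ↔ g ∈ H) :
    ∀ (X : Finset G), IsPeriodicWith H X → cosetCount L X = cosetCount L Hf * cosetCount H X := by
  intro X
  induction X using Finset.strongInduction with
  | H X ih => ?_
  intro hX
  rcases X.eq_empty_or_nonempty with rfl | ⟨x, hx⟩
  · rw [cosetCount_empty, cosetCount_empty, mul_zero]
  · have hsub : x +ᵥ Hf ⊆ X := by
      intro y hy
      obtain ⟨h, hh, rfl⟩ := mem_vadd_finset.1 hy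
      rw [vadd_eq_add, add_comm]
      exact hX.add_mem ((hHf h).1 hh) hx
    have hsplit : X = (x +ᵥ Hf) ∪ (X \ (x +ᵥ Hf)) := (union_sdiff_of_subset hsub).symm
    have hlt : X \ (x +ᵥ Hf) ⊂ X := by
      refine sdiff_ssubset hsub ⟨x, mem_vadd_finset.2 ⟨0, (hHf 0).2 H.zero_mem, by
        rw [vadd_eq_add, add_zero]⟩⟩
    have hper' : IsPeriodicWith H (X \ (x +ᵥ Hf)) := hX.sdiff (isPeriodicWith_vadd_carrier hHf x)
    have hrec := ih _ hlt hper'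
    have hdiffH : ∀ u ∈ x +ᵥ Hf, ∀ v ∈ X \ (x +ᵥ Hf), u - v ∉ H := by
      intro u hu v hv huv
      rw [mem_sdiff] at hv
      obtain ⟨h, hh, rfl⟩ := mem_vadd_finset.1 hu
      refine hv.2 (mem_vadd_finset.2 ⟨v - x, (hHf _).2 ?_, by rw [vadd_eq_add]; abel⟩)
      have e : v - x = h - ((x +ᵥ h) - v) := by rw [vadd_eq_add]; abel
      rw [e]; exact H.sub_mem ((hHf h).1 hh) huv
    have hdiffL : ∀ u ∈ x +ᵥ Hf, ∀ v ∈ X \ (x +ᵥ Hf), u - v ∉ L :=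
      fun u hu v hv huv => hdiffH u hu v hv (hLH huv)
    rw [hsplit, cosetCount_union hdiffL, cosetCount_union hdiffH, hrec, cosetCount_vadd,
      cosetCount_eq_one_of_sub_mem ⟨x, mem_vadd_finset.2 ⟨0, (hHf 0).2 H.zero_mem, by
        rw [vadd_eq_add, add_zero]⟩⟩ (fun u hu v hv => ?_)]
    · ring
    · obtain ⟨h, hh, rfl⟩ := mem_vadd_finset.1 hu
      obtain ⟨h', hh', rfl⟩ := mem_vadd_finset.1 hv
      rw [vadd_eq_add, vadd_eq_add, add_sub_add_left_eq_sub]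
      exact H.sub_mem ((hHf h).1 hh) ((hHf h').1 hh')

/-! ### Lifting a decomposition of the bottom pair -/

/-- Restricting the period group. [cite: Kemperman1960, §5] -/
theorem IsPeriodicWith.anti {K H : AddSubgroup G} (hKH : K ≤ H) {X : Finset G}
    (hX : IsPeriodicWith H X) : IsPeriodicWith K X := fun k hk => hX k (hKH hk)

section Lift

variable {K H : AddSubgroup G} {Hf A B A₁ A' B₁ B' A₁' A₀ B₁' B₀ : Finset G}

/-- The «coarse» data of a pair `(A, B)` relative to `H`: quasi-periodic decompositions
`A = A₁ ⊔ A'`, `B = B₁ ⊔ B'` with quasi-period `H`, `φ_H(A') + φ_H(B')` uniquely expressed in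
`φ_H(A) + φ_H(B)`, and `|φ_H(A + B)| = |φ_H(A)| + |φ_H(B)| − 1` (an element of Kemperman's `P₁(A, B)`
of norm one).  Consequence: the sums outside the coset of `A' + B'`.
[cite: Kemperman1960, §4 (P₁(A,B)); Thm 5.1 (proof)] -/
theorem sub_notMem_of_coarse (hdA : IsQuasiPeriodicDecomp H A A₁ A')
    (hdB : IsQuasiPeriodicDecomp H B B₁ B')
    (hi : ∀ a ∈ A, ∀ b ∈ B, ∀ a' ∈ A', ∀ b' ∈ B', (a + b) - (a' + b') ∈ H → a - a' ∈ H ∧ b - b' ∈ H)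
    {p c : G} (hp : p ∈ A₁ + B ∪ (A' + B₁)) (hc : c ∈ A' + B') : p - c ∉ H := by
  intro hpc
  obtain ⟨a', ha', b', hb', rfl⟩ := mem_add.1 hc
  rcases mem_union.1 hp with hp | hp
  · obtain ⟨a₁, ha₁, b, hb, rfl⟩ := mem_add.1 hp
    exact hdA.sub_notMem ha₁ ha' (hi a₁ (hdA.left_subset ha₁) b hb a' ha' b' hb' hpc).1
  · obtain ⟨a, ha, b₁, hb₁, rfl⟩ := mem_add.1 hp
    exact hdB.sub_notMem hb₁ hb' (hi a (hdA.right_subset ha) b₁ (hdB.left_subset hb₁) a' ha' b' hb' hpc).2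

/-- `A + B = (A₁ + B ∪ (A' + B₁)) ∪ (A' + B')`. [cite: Kemperman1960, Thm 5.1 (proof)] -/
theorem add_eq_of_coarse (hdA : IsQuasiPeriodicDecomp H A A₁ A') (hdB : IsQuasiPeriodicDecomp H B B₁ B') :
    A + B = (A₁ + B ∪ (A' + B₁)) ∪ (A' + B') := by
  have h1 : A + B = A₁ + B ∪ (A' + B) := by rw [← hdA.union_eq, union_add]
  have h2 : A' + B = A' + B₁ ∪ (A' + B') := by
    conv_lhs => rw [← hdB.union_eq]
    rw [add_union]
  rw [h1, h2, union_assoc]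

/-- **Lifting** (Kemperman 1960, proof of Theorem 5.1, inclusion (3) `P₁(A₁, B₁) ⊆ P₁(A, B)`): if
`(A, B)` has coarse data relative to `H` with bottom pair `(A', B')`, and `(A', B')` has a Kemperman
decomposition (Kemperman's form) with quasi-period `K ≤ H` and bottom pair `(A₀, B₀)`, then `(A, B)`
has one with quasi-period `K`, periodic parts `A₁ ∪ A₁'`, `B₁ ∪ B₁'` and the same bottom pair.
Finite `H` given by a carrier finset `Hf` (for the index `[H : K] = |φ_K(H)|`).
[cite: Kemperman1960, Thm 5.1 (proof, (3))] -/
theorem IsKempermanDecompI.lift (hKH : K ≤ H) (hHf : ∀ g, g ∈ Hf ↔ g ∈ H)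
    (hdA : IsQuasiPeriodicDecomp H A A₁ A') (hdB : IsQuasiPeriodicDecomp H B B₁ B')
    (hi : ∀ a ∈ A, ∀ b ∈ B, ∀ a' ∈ A', ∀ b' ∈ B', (a + b) - (a' + b') ∈ H → a - a' ∈ H ∧ b - b' ∈ H)
    (hii : cosetCount H (A + B) + 1 = cosetCount H A + cosetCount H B)
    (hK : IsKempermanDecompI K A' B' A₁' A₀ B₁' B₀) :
    IsKempermanDecompI K A B (A₁ ∪ A₁') A₀ (B₁ ∪ B₁') B₀ := by
  have hA₀ : A₀ ⊆ A' := hK.decomp_left.right_subset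
  have hB₀ : B₀ ⊆ B' := hK.decomp_right.right_subset
  have hA'ne : A'.Nonempty := hK.left_nonempty.mono hA₀
  have hB'ne : B'.Nonempty := hK.right_nonempty.mono hB₀
  refine
    { decomp_left := ⟨hK.decomp_left.ne_bot,
        disjoint_union_left.2 ⟨hdA.disjoint.mono_right hA₀, hK.decomp_left.disjoint⟩,
        by rw [union_assoc, hK.decomp_left.union_eq, hdA.union_eq],
        (hdA.periodic.anti hKH).union hK.decomp_left.periodic, hK.decomp_left.sub_mem⟩
      decomp_right := ⟨hK.decomp_right.ne_bot,
        disjoint_union_left.2 ⟨hdB.disjoint.mono_right hB₀, hK.decomp_right.disjoint⟩,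
        by rw [union_assoc, hK.decomp_right.union_eq, hdB.union_eq],
        (hdB.periodic.anti hKH).union hK.decomp_right.periodic, hK.decomp_right.sub_mem⟩
      left_nonempty := hK.left_nonempty
      right_nonempty := hK.right_nonempty
      quot_unique := ?_
      cosetCount_add := ?_
      elementary := hK.elementary }
  · intro a ha b hb a₀ ha₀ b₀ hb₀ hq
    obtain ⟨haH, hbH⟩ := hi a ha b hb a₀ (hA₀ ha₀) b₀ (hB₀ hb₀) (hKH hq)
    exact hK.quot_unique a (hdA.mem_right_of_sub_mem ha (hA₀ ha₀) haH) b
      (hdB.mem_right_of_sub_mem hb (hB₀ hb₀) hbH) a₀ ha₀ b₀ hb₀ hq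
  · -- the count
    set P := A₁ + B ∪ (A' + B₁) with hPdef
    have hPper : IsPeriodicWith H P := (hdA.periodic.add_right B).union (hdB.periodic.add_left A')
    have hsplit : A + B = P ∪ (A' + B') := add_eq_of_coarse hdA hdB
    have hdiffH : ∀ p ∈ P, ∀ c ∈ A' + B', p - c ∉ H := fun p hp c hc =>
      sub_notMem_of_coarse hdA hdB hi hp hc
    have hdiffK : ∀ p ∈ P, ∀ c ∈ A' + B', p - c ∉ K := fun p hp c hc h =>
      hdiffH p hp c hc (hKH h)
    have hone : cosetCount H (A' + B') = 1 := by
      refine cosetCount_eq_one_of_sub_mem (hA'ne.add hB'ne) fun x hx y hy => ?_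
      obtain ⟨a, ha, b, hb, rfl⟩ := mem_add.1 hx
      obtain ⟨a', ha', b', hb', rfl⟩ := mem_add.1 hy
      rw [add_sub_add_comm]
      exact H.add_mem (hdA.sub_mem a ha a' ha') (hdB.sub_mem b hb b' hb')
    have idx := cosetCount_eq_mul_of_isPeriodicWith hKH hHf
    have e1 : cosetCount K (A + B) = cosetCount K Hf * cosetCount H P + cosetCount K (A' + B') := by
      rw [hsplit, cosetCount_union hdiffK, idx P hPper]
    have e1H : cosetCount H (A + B) = cosetCount H P + 1 := by
      rw [hsplit, cosetCount_union hdiffH, hone]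
    have hAK : ∀ x ∈ A₁, ∀ y ∈ A', x - y ∉ K := fun x hx y hy h => hdA.sub_notMem hx hy (hKH h)
    have hBK : ∀ x ∈ B₁, ∀ y ∈ B', x - y ∉ K := fun x hx y hy h => hdB.sub_notMem hx hy (hKH h)
    have e2 : cosetCount K A = cosetCount K Hf * cosetCount H A₁ + cosetCount K A' := by
      conv_lhs => rw [← hdA.union_eq]
      rw [cosetCount_union hAK, idx A₁ hdA.periodic]
    have e3 : cosetCount K B = cosetCount K Hf * cosetCount H B₁ + cosetCount K B' := by
      conv_lhs => rw [← hdB.union_eq]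
      rw [cosetCount_union hBK, idx B₁ hdB.periodic]
    have e2H := hdA.cosetCount_eq hA'ne
    have e3H := hdB.cosetCount_eq hB'ne
    have hP : cosetCount H P = cosetCount H A₁ + cosetCount H B₁ := by
      rw [e1H, e2H, e3H] at hii; omega
    have hKc := hK.cosetCount_add
    rw [e1, e2, e3, hP, mul_add]
    generalize cosetCount K Hf * cosetCount H A₁ = u at *
    generalize cosetCount K Hf * cosetCount H B₁ = v at *
    omega

/-- The degenerate lift: if the bottom pair `(A', B')` of the coarse data is itself elementary, the
coarse data IS a Kemperman decomposition with quasi-period `H`.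
[cite: Kemperman1960, Thm 5.1 (proof: «If (A, B) itself is an elementary pair then the assertions
of Theorem 5.1 trivially hold with A₁ = A, B₁ = B, F = G»)] -/
theorem IsKempermanDecompI.of_coarse_elementary (hdA : IsQuasiPeriodicDecomp H A A₁ A')
    (hdB : IsQuasiPeriodicDecomp H B B₁ B')
    (hi : ∀ a ∈ A, ∀ b ∈ B, ∀ a' ∈ A', ∀ b' ∈ B', (a + b) - (a' + b') ∈ H → a - a' ∈ H ∧ b - b' ∈ H)
    (hii : cosetCount H (A + B) + 1 = cosetCount H A + cosetCount H B)
    (hE : IsElementaryPair A' B') : IsKempermanDecompI H A B A₁ A' B₁ B' where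
  decomp_left := hdA
  decomp_right := hdB
  left_nonempty := hE.nonempty.1
  right_nonempty := hE.nonempty.2
  quot_unique := hi
  cosetCount_add := hii
  elementary := hE

/-- The periodic part of a decomposition inside one `H`-coset has its quasi-period inside `H`.
[cite: Kemperman1960, Thm 5.1 (proof: «A₁ + B₁ is contained in an F-coset, thus, F₁ is a subgroup
of F»)] -/
theorem le_of_isQuasiPeriodicDecomp_of_sub_mem {A' A₁' A₀ : Finset G}
    (hK : IsQuasiPeriodicDecomp K A' A₁' A₀) (hA' : ∀ x ∈ A', ∀ y ∈ A', x - y ∈ H)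
    (hne : A₁'.Nonempty) : K ≤ H := by
  intro k hk
  obtain ⟨x, hx⟩ := hne
  have hxk : k + x ∈ A₁' := hK.periodic.add_mem hk hx
  have := hA' (k + x) (hK.left_subset hxk) x (hK.left_subset hx)
  rwa [add_sub_cancel_right] at this

/-- **Lifting, existence form**: coarse data relative to a finite `H` plus ANY Kemperman
decomposition of the bottom pair give a Kemperman decomposition of `(A, B)`.
[cite: Kemperman1960, Thm 5.1 (proof, (3))] -/
theorem exists_isKempermanDecompI_of_coarse (hHf : ∀ g, g ∈ Hf ↔ g ∈ H)
    (hdA : IsQuasiPeriodicDecomp H A A₁ A') (hdB : IsQuasiPeriodicDecomp H B B₁ B')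
    (hi : ∀ a ∈ A, ∀ b ∈ B, ∀ a' ∈ A', ∀ b' ∈ B', (a + b) - (a' + b') ∈ H → a - a' ∈ H ∧ b - b' ∈ H)
    (hii : cosetCount H (A + B) + 1 = cosetCount H A + cosetCount H B)
    (hK : IsKempermanDecompI K A' B' A₁' A₀ B₁' B₀) :
    ∃ (L : AddSubgroup G) (X₁ X₀ Y₁ Y₀ : Finset G), IsKempermanDecompI L A B X₁ X₀ Y₁ Y₀ := by
  by_cases hne : A₁'.Nonempty ∨ B₁'.Nonempty
  · have hKH : K ≤ H := by
      rcases hne with hne | hne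
      · exact le_of_isQuasiPeriodicDecomp_of_sub_mem hK.decomp_left hdA.sub_mem hne
      · exact le_of_isQuasiPeriodicDecomp_of_sub_mem hK.decomp_right hdB.sub_mem hne
    exact ⟨K, _, _, _, _, hK.lift hKH hHf hdA hdB hi hii⟩
  · rw [not_or, not_nonempty_iff_eq_empty, not_nonempty_iff_eq_empty] at hne
    have hA₀ : A₀ = A' := by
      have := hK.decomp_left.union_eq; rwa [hne.1, empty_union] at this
    have hB₀ : B₀ = B' := by
      have := hK.decomp_right.union_eq; rwa [hne.2, empty_union] at this
    have hE := hK.elementary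
    rw [hA₀, hB₀] at hE
    exact ⟨H, A₁, A', B₁, B', IsKempermanDecompI.of_coarse_elementary hdA hdB hi hii hE⟩

end Lift

/-! ### Inheritance of Kemperman's hypothesis (2) by the bottom pair -/

section Inherit

variable {H : AddSubgroup G} {A B A₁ A' B₁ B' : Finset G}

/-- A unique expression element of `A + B` either lies in `A' + B'` and is uniquely expressed there,
or forces `|A'| = 1` or `|B'| = 1` (it cannot come from the two periodic parts, `|H| ≥ 2`).
[cite: Kemperman1960, Thm 5.1 (proof: «C₁'' contains an element c with ν_c(A₁, B₁) = ν_c(A, B) = 1»)] -/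
theorem addConvolution_bottom_of_coarse (hdA : IsQuasiPeriodicDecomp H A A₁ A')
    (hdB : IsQuasiPeriodicDecomp H B B₁ B') {c : G} (hc : A.addConvolution B c = 1) :
    (∃ c', A'.addConvolution B' c' = 1) ∨ #A' = 1 ∨ #B' = 1 := by
  obtain ⟨b, hb, hbA, huniq⟩ := addConvolution_eq_one_iff.1 hc
  set a := c - b with hadef
  have hca : c = a + b := by rw [hadef, sub_add_cancel]
  have huniq' : ∀ a' ∈ A, ∀ b' ∈ B, a' + b' = c → b' = b := fun a' ha' b' hb' he =>
    huniq b' hb' (by rw [← he, add_sub_cancel_right]; exact ha')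
  have haA : a ∈ A := hbA
  rw [← hdA.union_eq, mem_union] at haA
  have hbB : b ∈ B := hb
  rw [← hdB.union_eq, mem_union] at hbB
  rcases haA with ha₁ | ha'
  · rcases hbB with hb₁ | hb'
    · -- both in the periodic parts: `(a + h) + (b − h) = c` for `h ∈ H ∖ 0`
      exfalso
      obtain ⟨h, hh, hh0⟩ := H.bot_or_exists_ne_zero.resolve_left hdA.ne_bot
      have h1 : a + h ∈ A := hdA.left_subset (by rw [add_comm]; exact hdA.periodic.add_mem hh ha₁)
      have h2 : b - h ∈ B := hdB.left_subset (by
        rw [sub_eq_add_neg, add_comm]; exact hdB.periodic.add_mem (H.neg_mem hh) hb₁)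
      have := huniq' (a + h) h1 (b - h) h2 (by rw [hca]; abel)
      exact hh0 (by simpa using this)
    · -- `a ∈ A₁`, `b ∈ B'`: every `b'' ∈ B'` gives the representation `(a + b − b'') + b''`
      right; right
      rw [card_eq_one]
      refine ⟨b, eq_singleton_iff_unique_mem.2 ⟨hb', fun b'' hb'' => ?_⟩⟩
      have h1 : a + (b - b'') ∈ A := hdA.left_subset (by
        rw [add_comm]; exact hdA.periodic.add_mem (hdB.sub_mem b hb' b'' hb'') ha₁)
      exact huniq' _ h1 b'' (hdB.right_subset hb'') (by rw [hca]; abel)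
  · rcases hbB with hb₁ | hb'
    · -- `a ∈ A'`, `b ∈ B₁`: every `a'' ∈ A'` gives `a'' + (b + a − a'')`
      right; left
      rw [card_eq_one]
      refine ⟨a, eq_singleton_iff_unique_mem.2 ⟨ha', fun a'' ha'' => ?_⟩⟩
      have h2 : b + (a - a'') ∈ B := hdB.left_subset (by
        rw [add_comm]; exact hdB.periodic.add_mem (hdA.sub_mem a ha' a'' ha'') hb₁)
      have := huniq' a'' (hdA.right_subset ha'') _ h2 (by rw [hca]; abel)
      -- `b + (a − a'') = b` gives `a'' = a`
      have : a - a'' = 0 := by simpa using this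
      rw [sub_eq_zero] at this
      exact this.symm
    · -- both in the bottom pair
      left
      refine ⟨c, addConvolution_eq_one_iff.2 ⟨b, hb', ?_, fun b'' hb'' h => ?_⟩⟩
      · exact ha'
      · exact huniq b'' (hdB.right_subset hb'') (hdA.right_subset h)

/-- Aperiodicity of `A + B` passes to the bottom sum `A' + B'` (a period of `A' + B'`, a set inside
one `H`-coset, lies in `H`, and the rest of `A + B` is `H`-periodic).
[cite: Kemperman1960, Thm 5.1 (proof: «if A + B is periodic then A₁ + B₁ is periodic» — read
contrapositively for the parts)] -/
theorem not_isPeriodic_bottom_of_coarse (hdA : IsQuasiPeriodicDecomp H A A₁ A')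
    (hdB : IsQuasiPeriodicDecomp H B B₁ B') (hA' : A'.Nonempty) (hB' : B'.Nonempty)
    (hAB : ¬ IsPeriodic (A + B)) : ¬ IsPeriodic (A' + B') := by
  rintro ⟨Q, hQ, hQper⟩
  have hQH : Q ≤ H := by
    intro q hq
    obtain ⟨x, hx⟩ := hA'.add hB'
    have hqx : q + x ∈ A' + B' := hQper.add_mem hq hx
    obtain ⟨a, ha, b, hb, rfl⟩ := mem_add.1 hx
    obtain ⟨a', ha', b', hb', he⟩ := mem_add.1 hqx
    have e : q = (a' - a) + (b' - b) := by
      have e1 : q = (a' + b') - (a + b) := by rw [he, add_sub_cancel_right]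
      rw [e1]; abel
    rw [e]
    exact H.add_mem (hdA.sub_mem a' ha' a ha) (hdB.sub_mem b' hb' b hb)
  refine hAB ⟨Q, hQ, ?_⟩
  rw [add_eq_of_coarse hdA hdB]
  exact (((hdA.periodic.add_right B).union (hdB.periodic.add_left A')).anti hQH).union hQper

/-- **Coarse data + the structure of the bottom pair ⟹ a Kemperman decomposition** (the inductive
step of the «only if» half of KST along a chain): if the bottom pair `(A', B')` of coarse data
relative to a finite `H` admits a Kemperman decomposition WHENEVER it satisfies Kemperman's
hypothesis (2) («`A' + B'` aperiodic or with a unique expression element»), then so does `(A, B)`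
whenever IT satisfies (2).  [cite: Kemperman1960, Thm 5.1 (proof)] -/
theorem exists_isKempermanDecompI_of_coarse_of_imp {Hf : Finset G} (hHf : ∀ g, g ∈ Hf ↔ g ∈ H)
    (hdA : IsQuasiPeriodicDecomp H A A₁ A') (hdB : IsQuasiPeriodicDecomp H B B₁ B')
    (hA' : A'.Nonempty) (hB' : B'.Nonempty)
    (hi : ∀ a ∈ A, ∀ b ∈ B, ∀ a' ∈ A', ∀ b' ∈ B', (a + b) - (a' + b') ∈ H → a - a' ∈ H ∧ b - b' ∈ H)
    (hii : cosetCount H (A + B) + 1 = cosetCount H A + cosetCount H B)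
    (hbottom : (¬ IsPeriodic (A' + B') ∨ ∃ c, A'.addConvolution B' c = 1) →
      ∃ (K : AddSubgroup G) (A₁' A₀ B₁' B₀ : Finset G), IsKempermanDecompI K A' B' A₁' A₀ B₁' B₀)
    (hyp : ¬ IsPeriodic (A + B) ∨ ∃ c, A.addConvolution B c = 1) :
    ∃ (L : AddSubgroup G) (X₁ X₀ Y₁ Y₀ : Finset G), IsKempermanDecompI L A B X₁ X₀ Y₁ Y₀ := by
  -- the type (I) escape
  by_cases hI : #A' = 1 ∨ #B' = 1
  · have hE : IsElementaryPair A' B' := Or.inl ⟨hA', hB', hI⟩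
    exact ⟨H, A₁, A', B₁, B', IsKempermanDecompI.of_coarse_elementary hdA hdB hi hii hE⟩
  · have hyp' : ¬ IsPeriodic (A' + B') ∨ ∃ c, A'.addConvolution B' c = 1 := by
      rcases hyp with h | ⟨c, hc⟩
      · exact Or.inl (not_isPeriodic_bottom_of_coarse hdA hdB hA' hB' h)
      · rcases addConvolution_bottom_of_coarse hdA hdB hc with h | h
        · exact Or.inr h
        · exact absurd h hI
    obtain ⟨K, A₁', A₀, B₁', B₀, hK⟩ := hbottom hyp'
    exact exists_isKempermanDecompI_of_coarse hHf hdA hdB hi hii hK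

end Inherit

end Literature.Combinatorics.Additive
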